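import Summits.Ventures.DiscreteObjects.UnitDistance.PlaneSqrt47Rup1
import Summits.Ventures.DiscreteObjects.UnitDistance.QuadraticFieldsAtlas
import Summits.Ventures.DiscreteObjects.UnitDistance.PlaneSqrt11Four
import HarnessLib

/-!
# `χ(ℚ(√47)²) ≥ 4`: the plane over `ℚ(√47)` is not 3-colourable (cell `pub-namedobj`, target (U), seat udg g13)

Framing (verbatim for the cell): lottery ticket; floor = certified bounds/negative ranges.

Before this file the tree had `3 ≤ χ(ℚ(√47)²) ≤ 5`: the odd cycle of `OddCycles.lean` (`47 ≡ 3 (mod 4)`) and the `11`-adic criterion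
`colorable_five_plane_of_elevenAdic` of `PadicCriterion.lean` (`47 ≡ 5² (mod 11)`; the atlas `QuadraticFieldsAtlas.lean` records `d = 47` as
`Covered`).  No 4-colouring of `ℚ(√47)²` is known: `47 ≡ 7 (mod 8)` (the 2-adic place is isotropic), `47 ≡ 2 (mod 3)`, and `47` is a
non-residue mod `7`.  Here the lower bound is raised to `4`, so `χ(ℚ(√47)²) ∈ {4, 5}`.  The abstract
graph `w47Graph` on `Fin 171` (adjacency = the exact integer unit test `unitStep47` on the coordinate table of
`PlaneSqrt47WitnessData.lean`) is not 3-colourable (kernel RUP certificate `w47rup1…`, soundness `KRup.checkAll_sound`); the map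
`v ↦ pt47 (w47c v)` is a graph homomorphism into the unit-distance graph of `ℚ(√47)²` (`w47Hom`); hence `4 ≤ χ(ℚ(√47)²) ≤ 5`
(`chromaticNumber_plane_sqrt47_bounds`) and `χ(K²) ≥ 4` for every field `K ∋ √47`.  The witness is triangle-free, as is every unit-distance
graph over `ℚ(√47)` (`TriangleFreeFieldPlanes.lean`); Madore (arXiv:1509.07023 §2): 'practically the only two useful graphs known
in this context are the triangle and Moser's spindle' — this one is neither.  Value and witness not found in print (PROVISIONAL).
-/

noncomputable section

namespace Summit.Ventures.DiscreteObjects.UnitDistance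

open SimpleGraph KRup IntermediateField
open scoped IntermediateField

/-! ## The abstract witness graph -/

/-- The integer unit test never holds between a point and itself (`0 ≠ 3600`). -/
theorem unitStep47_self (p : ℤ × ℤ × ℤ × ℤ) : unitStep47 p p = false := by
  simp [unitStep47]

/-- The integer unit test is symmetric. -/
theorem unitStep47_comm (p q : ℤ × ℤ × ℤ × ℤ) : unitStep47 p q = unitStep47 q p := by
  have h1 : (p.1 - q.1) ^ 2 + 47 * (p.2.1 - q.2.1) ^ 2 + (p.2.2.1 - q.2.2.1) ^ 2 + 47 * (p.2.2.2 - q.2.2.2) ^ 2 =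
      (q.1 - p.1) ^ 2 + 47 * (q.2.1 - p.2.1) ^ 2 + (q.2.2.1 - p.2.2.1) ^ 2 + 47 * (q.2.2.2 - p.2.2.2) ^ 2 := by ring
  have h2 : (p.1 - q.1) * (p.2.1 - q.2.1) + (p.2.2.1 - q.2.2.1) * (p.2.2.2 - q.2.2.2) =
      (q.1 - p.1) * (q.2.1 - p.2.1) + (q.2.2.1 - p.2.2.1) * (q.2.2.2 - p.2.2.2) := by ring
  simp only [unitStep47, h1, h2]

/-- THE WITNESS GRAPH `W_47` on `Fin 171`: `v ~ w` iff the exact unit test holds on the coordinate table. -/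
def w47Graph : SimpleGraph (Fin 171) where
  Adj v w := unitStep47 (w47c v) (w47c w) = true
  symm := ⟨fun v w h => by rw [unitStep47_comm]; exact h⟩
  loopless := ⟨fun v h => by rw [unitStep47_self] at h; exact Bool.false_ne_true h⟩

/-- Adjacency of the witness graph is decidable (it is a Boolean test). -/
instance : DecidableRel w47Graph.Adj := fun v w => inferInstanceAs (Decidable (unitStep47 (w47c v) (w47c w) = true))

/-- KERNEL FACT: every clause of the 3-colouring CNF has an admissible shape (vertex / edge-of-the-graph / unit). -/
theorem w47cnf_valid : (cnfOf w47nb 171 0 6).all (validClause w47nb 171 0 6) = true := by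
  decide +kernel

/-- KERNEL FACT: the last piece of the certificate derives the empty clause. -/
theorem w47nil : ([] : List ℕ) ∈ w47steps1.map Prod.fst := by
  decide +kernel

set_option maxRecDepth 2000000 in
/-- `W_47` IS NOT 3-COLOURABLE (kernel RUP certificate + `KRup.checkAll_sound`; WLOG `0 ↦ 0`, `6 ↦ 1`). -/
theorem not_colorable_three_w47Graph : ¬ w47Graph.Colorable 3 := by
  rintro ⟨C⟩
  have h01 : C ⟨0, by norm_num⟩ ≠ C ⟨6, by norm_num⟩ := C.valid w47_edge01
  obtain ⟨σ, hσ0, hσ1⟩ := exists_perm_fin3 _ _ h01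
  let col : ℕ → ℕ := fun v => if h : v < 171 then (σ (C ⟨v, h⟩)).val else 0
  have hcol : ∀ v (h : v < 171), col v = (σ (C ⟨v, h⟩)).val := fun v h => dif_pos h
  have hP : Proper3 w47nb 171 col := by
    intro v hv
    refine ⟨by rw [hcol v hv]; exact (σ (C ⟨v, hv⟩)).isLt, ?_⟩
    intro w hw hbit heq
    have hu := (w47_unit_of_testBit v w hv hbit).2
    have hvalid : C ⟨v, hv⟩ ≠ C ⟨w, hw⟩ := C.valid hu
    rw [hcol v hv, hcol w hw] at heq
    exact hvalid (σ.injective (Fin.ext heq)).symm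
  have h0 : col 0 = 0 := by rw [hcol 0 (by norm_num), hσ0]; rfl
  have h1 : col 6 = 1 := by rw [hcol 6 (by norm_num), hσ1]; rfl
  have H0 := all_true_of_valid hP h0 h1 w47cnf_valid
  have A1 : ∀ C ∈ cnfOf w47nb 171 0 6 ++ w47pre1, clauseTrue (assignOf col) C = true := by
    intro C hC; rw [List.mem_append] at hC
    rcases hC with h | h
    · exact H0 C h
    · simp [w47pre1] at h
  have S1 : ∀ C ∈ w47steps1.map Prod.fst, clauseTrue (assignOf col) C = true :=
    checkAll_sound (σ := assignOf col) 127 12 (S := Store.ofList 12 (cnfOf w47nb 171 0 6 ++ w47pre1))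
      _ w47steps1 (Store.All.ofList 12 A1) w47rup1
  have hnil := S1 [] w47nil
  simp [clauseTrue] at hnil

/-- An explicit proper 4-colouring of `W_47` (colour list, checked by `decide`). -/
def w47col4 : List (Fin 4) := [0, 1, 1, 3, 1, 2, 1, 1, 1, 1, 1, 1, 1, 1, 1, 2, 1, 1, 1, 1, 2, 2, 2, 2, 0, 0, 0, 2, 1, 0, 0, 2, 0, 2, 2, 0, 3, 1, 1, 2, 2, 0, 2, 2, 3, 0, 0, 2, 0, 0, 2, 0, 2, 2, 2, 2, 3, 2, 2, 1, 0, 2, 0, 3, 0, 0, 1, 2, 2, 2, 0, 0, 0, 1, 1, 1, 0, 1, 1, 1, 1, 1, 0, 0, 0, 3, 0, 0, 2, 1, 0, 3, 0, 0, 1, 0, 1, 0, 2, 1, 0, 2, 0, 2, 3, 2, 2, 2, 0, 3, 0, 0, 0, 0, 0, 0, 0, 0, 0, 1, 2, 2, 3, 2, 3, 0, 0, 2, 2, 2, 2, 0, 0, 2, 2, 1, 1, 3, 3, 3, 0, 0, 3, 3, 1, 1, 2, 3, 1, 1, 1, 1, 2, 0, 1, 3, 1, 3, 1, 2, 1, 2,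 2, 1, 2, 2, 1, 1, 1, 2, 2]

/-- `W_47` is 4-colourable, so `χ(W_47) = 4`. -/
theorem colorable_four_w47Graph : w47Graph.Colorable 4 := by
  refine ⟨Coloring.mk (fun v => w47col4.getD v.val 0) ?_⟩
  intro v w hvw
  have key : ∀ v w : Fin 171, unitStep47 (w47c v) (w47c w) = true → w47col4.getD v.val 0 ≠ w47col4.getD w.val 0 := by
    decide +kernel
  exact key v w hvw

/-- `χ(W_47) = 4`. -/
theorem chromaticNumber_w47Graph : w47Graph.chromaticNumber = 4 := by
  apply le_antisymm colorable_four_w47Graph.chromaticNumber_le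
  by_contra hlt
  have hlt' : w47Graph.chromaticNumber < (3 : ℕ∞) + 1 := lt_of_not_ge hlt
  have hle : w47Graph.chromaticNumber ≤ (3 : ℕ) := Order.le_of_lt_add_one hlt'
  exact not_colorable_three_w47Graph (chromaticNumber_le_iff_colorable.mp hle)

/-! ## Realisation in `ℚ(√47)²` -/

/-- The plane point with integer data `(A, B, C, E)`: `((A + B√47)/60, (C + E√47)/60)`. -/
def pt47 (p : ℤ × ℤ × ℤ × ℤ) : EuclideanSpace ℝ (Fin 2) :=
  !₂[((p.1 : ℝ) + (p.2.1 : ℝ) * Real.sqrt 47) / 60, ((p.2.2.1 : ℝ) + (p.2.2.2 : ℝ) * Real.sqrt 47) / 60]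

/-- The integer unit test implies unit distance. -/
theorem dist_pt47_eq_one {p q : ℤ × ℤ × ℤ × ℤ} (h : unitStep47 p q = true) : dist (pt47 p) (pt47 q) = 1 := by
  obtain ⟨a, b, c, e⟩ := p
  obtain ⟨a', b', c', e'⟩ := q
  simp only [unitStep47, Bool.and_eq_true, beq_iff_eq] at h
  obtain ⟨h1, h2⟩ := h
  have s : Real.sqrt 47 ^ 2 = 47 := Real.sq_sqrt (by norm_num)
  have h1' : ((a' : ℝ) - a) ^ 2 + 47 * ((b' : ℝ) - b) ^ 2 + ((c' : ℝ) - c) ^ 2 + 47 * ((e' : ℝ) - e) ^ 2 = 3600 := by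
    exact_mod_cast h1
  have h2' : ((a' : ℝ) - a) * ((b' : ℝ) - b) + ((c' : ℝ) - c) * ((e' : ℝ) - e) = 0 := by exact_mod_cast h2
  have hd : dist (pt47 (a, b, c, e)) (pt47 (a', b', c', e')) ^ 2 = 1 := by
    rw [EuclideanSpace.dist_sq_eq, Fin.sum_univ_two, Real.dist_eq, Real.dist_eq, sq_abs, sq_abs]
    simp [pt47]
    linear_combination (1 / 3600 : ℝ) * h1' + (((b : ℝ) - b') ^ 2 + ((e : ℝ) - e') ^ 2) / 3600 * s +
      (2 * Real.sqrt 47 / 3600) * h2'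
  exact (pow_eq_one_iff_of_nonneg dist_nonneg two_ne_zero).1 hd

/-- Every point `pt47 p` lies in `ℚ(√47)²`. -/
theorem pt47_mem (p : ℤ × ℤ × ℤ × ℤ) : pt47 p ∈ fieldPoints ℚ⟮Real.sqrt 47⟯ := by
  have hs : Real.sqrt 47 ∈ ℚ⟮Real.sqrt 47⟯ := mem_adjoin_simple_self ℚ _
  intro i
  fin_cases i
  · change ((p.1 : ℝ) + (p.2.1 : ℝ) * Real.sqrt 47) / 60 ∈ ℚ⟮Real.sqrt 47⟯
    exact div_mem (add_mem (intCast_mem _ _) (mul_mem (intCast_mem _ _) hs)) (ofNat_mem _ 60)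
  · change ((p.2.2.1 : ℝ) + (p.2.2.2 : ℝ) * Real.sqrt 47) / 60 ∈ ℚ⟮Real.sqrt 47⟯
    exact div_mem (add_mem (intCast_mem _ _) (mul_mem (intCast_mem _ _) hs)) (ofNat_mem _ 60)

/-- The realisation homomorphism `W_47 →g Γ(ℚ(√47)²)`, `v ↦ pt47 (w47c v)`. -/
def w47Hom : w47Graph →g planeUnitDistanceGraph.induce (fieldPoints ℚ⟮Real.sqrt 47⟯) where
  toFun v := ⟨pt47 (w47c v), pt47_mem _⟩
  map_rel' h := dist_pt47_eq_one h

/-- THE PLANE OVER `ℚ(√47)` IS NOT 3-COLOURABLE. -/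
theorem not_colorable_three_plane_sqrt47 :
    ¬ (planeUnitDistanceGraph.induce (fieldPoints ℚ⟮Real.sqrt 47⟯)).Colorable 3 :=
  fun h => not_colorable_three_w47Graph (h.of_hom w47Hom)

/-- `4 ≤ χ(ℚ(√47)²) ≤ 5` (lower bound: the witness; upper bound: the 11-adic criterion `colorable_five_plane_of_elevenAdic` (`PadicPattern 11 {47}`)). -/
theorem chromaticNumber_plane_sqrt47_bounds :
    4 ≤ (planeUnitDistanceGraph.induce (fieldPoints ℚ⟮Real.sqrt 47⟯)).chromaticNumber ∧
      (planeUnitDistanceGraph.induce (fieldPoints ℚ⟮Real.sqrt 47⟯)).chromaticNumber ≤ 5 := by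
  have h5 : (planeUnitDistanceGraph.induce (fieldPoints ℚ⟮Real.sqrt 47⟯)).Colorable 5 := by
    have h := colorable_five_plane_of_elevenAdic {47} (by decide)
    rw [multiSqrtField_singleton, Nat.cast_ofNat] at h
    exact h
  refine ⟨?_, h5.chromaticNumber_le⟩
  by_contra hlt
  have hlt' : (planeUnitDistanceGraph.induce (fieldPoints ℚ⟮Real.sqrt 47⟯)).chromaticNumber < (3 : ℕ∞) + 1 :=
    lt_of_not_ge hlt
  have hle : (planeUnitDistanceGraph.induce (fieldPoints ℚ⟮Real.sqrt 47⟯)).chromaticNumber ≤ (3 : ℕ) :=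
    Order.le_of_lt_add_one hlt'
  exact not_colorable_three_plane_sqrt47 (chromaticNumber_le_iff_colorable.mp hle)

/-- Atlas form: `4 ≤ χ(ℚ(√d : d ∈ {47})²) ≤ 5`. -/
theorem chromaticNumber_plane_multiSqrtField_47_bounds :
    4 ≤ (planeUnitDistanceGraph.induce (fieldPoints (multiSqrtField {47}))).chromaticNumber ∧
      (planeUnitDistanceGraph.induce (fieldPoints (multiSqrtField {47}))).chromaticNumber ≤ 5 := by
  rw [multiSqrtField_singleton, Nat.cast_ofNat]
  exact chromaticNumber_plane_sqrt47_bounds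

/-- Every field `K ⊇ ℚ(√47)` has `χ(K²) ≥ 4`. -/
theorem not_colorable_three_plane_of_sqrt47_mem (K : IntermediateField ℚ ℝ) (h : Real.sqrt 47 ∈ K) :
    ¬ (planeUnitDistanceGraph.induce (fieldPoints K)).Colorable 3 := by
  have hle : ℚ⟮Real.sqrt 47⟯ ≤ K := adjoin_simple_le_iff.2 h
  exact fun hK => not_colorable_three_plane_sqrt47 (colorable_plane_of_le hle hK)

end Summit.Ventures.DiscreteObjects.UnitDistance
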